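import Summits.CriticalPhenomena.CardyFormulaZ2.Theorems.CardySelfDualSegmentUniformBoxCrossingKernelNecessary
import Summits.CriticalPhenomena.CardyFormulaZ2.Theorems.CardySelfDualSegmentSegmentClosedStubInscribedTB
import Literature.Probability.Percolation.QuadCrossingSquareModel
import HarnessLib

/-!
# Sub-goal `stub_crudeLeLrCrossing` of line `Sketch` (crux `UniformMarginality`, stmt-CriticalPhenomena-5472)

Route `CardySelfDualSegment` of `CriticalPhenomena/CardyFormulaZ2`, crux `UniformMarginality`
(stmt-CriticalPhenomena-5472), line `Sketch`: "the route's Target (Cardy limits for every corner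
model `M_t`) ⟹ pointwise box crossing for every `M_t`". This file proves its GEOMETRIC SANDWICH
`stub_crudeLeLrCrossing`: for natural numbers `k, M, N, m` with `3 M + 16 ≤ (4 k + 4) m` and
`5 m ≤ 7 N`, the crude crossing probability `cornerCrossingProb t Q (1/m)` of the tall model
rectangle `Q = rectQuad 0 1 0 (2k + 2) = (0, 1) × (0, 2k + 2)` at mesh `δ = 1/m` (an open path of
`M_t = cornerPercolation t` drawn on `√2 ℤ²` and rescaled by `δ`, all of whose vertices lie in the
open rectangle, from within `2δ` of the bottom side `Q.arc 0` to within `2δ` of the top side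
`Q.arc 2`) is at most the `M_t`-probability of a left–right open crossing of the lattice rectangle
`[0, M] × [0, N]`.

Proof (every ingredient is a tree theorem; this is the height-`2k + 2` version of the
height-`4` sandwich `stub_crudeLeNonSlant`, with the simpler ending at `lrCrossing M N`):
* `cornerCrossingProb_eq` rewrites the left side as the `M_t`-probability of the crude crossing
  event `embDomainCrossing squareLatticeEmbedding.z Q.carrier δ (Q.arc 0) (Q.arc 2)`.
* Forced gate (`stub_gateTB` with `H = 2k + 2`, `y₁ = 2δ`, `y₂ = H - 2δ`, `x₁ = 0`, `x₂ = 1`,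
  `a = m`, `b = H m - 8 = (y₂ - y₁)/δ - 4`): a point within `2δ` of the bottom side has height
  `≤ 2δ` (`im_sub_le_infDist_rectQuad_arc_zero`), one within `2δ` of the top side has height
  `≥ H - 2δ` (`sub_im_le_infDist_rectQuad_arc_two`), and points of `Q` have `re ∈ [0, 1]`; so on
  lattice configurations the crude crossing event lies in the top–bottom crossing event of a
  translate `w + [0, m] × [0, H m - 8]` of a Euclidean box, and since `M_t` is carried by lattice
  configurations this is an inequality of probabilities (`cornerPercolation_real_mono_of_lattice'`).
  Here `H m ≥ 8` because `(4 k + 4) m ≥ 3 M + 16 ≥ 16`.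
* Transposition (`cornerPercolation_real_embTBCrossing_eq_real_embRectCrossing`) turns it into the
  horizontal crossing of `w̃ + [0, H m - 8] × [0, m]`, `w̃ = (im w, re w)`, which is `M_t`-a.s.
  inside the left–right crossing of a lattice rectangle `[0, M'] × [0, N']`
  (`cornerPercolation_real_embRectCrossing_le_real_lrCrossing` with
  `M' = ⌈(w̃.re + H m - 8)/√2⌉ - ⌊w̃.re/√2⌋ ≥ (H m - 8)/√2 ≥ M` and
  `N' = ⌊(w̃.im + m)/√2⌋ - ⌈w̃.im/√2⌉ ≤ m/√2 ≤ N`, by `7/5 < √2 < 3/2` (`sqrt_two_bounds`) and the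
  two hypotheses: `M √2 ≤ 3M/2 ≤ H m - 8` is `3 M + 16 ≤ (4 k + 4) m`, and `m ≤ 7N/5 ≤ N √2` is
  `5 m ≤ 7 N`).
* Antitonicity in the width (`cornerPercolation_real_lrCrossing_anti_left`) and monotonicity in
  the height (`lrCrossing_mono_right`) finish:
  `M_t(LR(M', N')) ≤ M_t(LR(M, N')) ≤ M_t(LR(M, N))`.
-/

noncomputable section

open Set Filter Metric MeasureTheory Complex
open scoped Topology
open Literature.Probability.RandomPlanarGeometry Literature.Probability.Percolation
open Literature.Probability.LatticeModels
open Summit.CriticalPhenomena.CardyFormulaZ2.Cruxes.SegmentClosed.Sketch (stub_gateTB stub_inscribedTB)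
open Summit.CriticalPhenomena.CardyFormulaZ2.Cruxes.UniformBoxCrossing.NonSlantLine

namespace Summit.CriticalPhenomena.CardyFormulaZ2.Cruxes.UniformMarginality.HeatFlow

/-- `M_t` is carried by lattice configurations (`cornerPercolation_subset_edgeSet`), so an
inclusion of events valid on lattice configurations gives an inequality of `M_t`-probabilities.
(Private primed copy of the line's `cornerPercolation_real_mono_of_lattice`.) -/
private theorem cornerPercolation_real_mono_of_lattice' (t : unitInterval)
    {E F : Set (BondConfig (Site 2))}
    (h : ∀ ω : BondConfig (Site 2), ω ⊆ (zdGraph 2).edgeSet → ω ∈ E → ω ∈ F) :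
    (cornerPercolation t).real E ≤ (cornerPercolation t).real F := by
  simp only [measureReal_def]
  refine ENNReal.toReal_mono (measure_ne_top _ _) (measure_mono_ae ?_)
  filter_upwards [cornerPercolation_subset_edgeSet t] with ω hω hE
  exact h ω hω hE

/-- The height of a point above the bottom side `arc 0 = [x₀, x₁] × {y₀}` of the model rectangle
is at most its distance to that side: `p.im - y₀ ≤ infDist p (arc 0)` (for `a` on the side,
`p.im - y₀ = im (p - a) ≤ ‖p - a‖`). -/
private theorem im_sub_le_infDist_rectQuad_arc_zero {x₀ x₁ y₀ y₁ : ℝ} (hx : x₀ < x₁)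
    (hy : y₀ < y₁) (p : ℂ) :
    p.im - y₀ ≤ infDist p ((rectQuad x₀ x₁ y₀ y₁ hx hy).arc 0) := by
  refine (le_infDist ⟨⟨x₀, y₀⟩, ?_⟩).2 fun a ha => ?_
  · rw [mem_rectQuad_arc_zero]
    exact ⟨rfl, left_mem_Icc.2 hx.le⟩
  · rw [mem_rectQuad_arc_zero] at ha
    calc p.im - y₀ = (p - a).im := by rw [Complex.sub_im, ha.1]
      _ ≤ |(p - a).im| := le_abs_self _
      _ ≤ ‖p - a‖ := Complex.abs_im_le_norm _
      _ = dist p a := (Complex.dist_eq p a).symm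

/-- The depth of a point below the top side `arc 2 = [x₀, x₁] × {y₁}` of the model rectangle is
at most its distance to that side: `y₁ - p.im ≤ infDist p (arc 2)`. -/
private theorem sub_im_le_infDist_rectQuad_arc_two {x₀ x₁ y₀ y₁ : ℝ} (hx : x₀ < x₁)
    (hy : y₀ < y₁) (p : ℂ) :
    y₁ - p.im ≤ infDist p ((rectQuad x₀ x₁ y₀ y₁ hx hy).arc 2) := by
  refine (le_infDist ⟨⟨x₀, y₁⟩, ?_⟩).2 fun a ha => ?_
  · rw [mem_rectQuad_arc_two]
    exact ⟨rfl, left_mem_Icc.2 hx.le⟩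
  · rw [mem_rectQuad_arc_two] at ha
    calc y₁ - p.im = (a - p).im := by rw [Complex.sub_im, ha.1]
      _ ≤ |(a - p).im| := le_abs_self _
      _ ≤ ‖a - p‖ := Complex.abs_im_le_norm _
      _ = dist p a := by rw [Complex.dist_eq, norm_sub_rev]

/-- **Geometric sandwich: the crude crossing of the tall rectangle `Q = (0, 1) × (0, 2k + 2)`
inside a left–right crossing of a lattice rectangle.** For `3 M + 16 ≤ (4 k + 4) m` and
`5 m ≤ 7 N`, the crude `M_t`-crossing probability of the model rectangle `Q` at mesh `1/m` is at
most the `M_t`-probability of a left–right open crossing of the lattice rectangle `[0, M] × [0, N]`: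
the forced gate `stub_gateTB` puts the crude crossing inside a top–bottom crossing of a translate
of the Euclidean box `[0, m] × [0, (2k + 2) m - 8]`, which (transposition symmetry,
`cornerPercolation_real_embRectCrossing_le_real_lrCrossing`, `7/5 < √2 < 3/2`) has probability at
most `M_t(LR([0, M'] × [0, N']))` with `M ≤ M'` and `N' ≤ N`; antitonicity in the width and
monotonicity in the height conclude. -/
theorem stub_crudeLeLrCrossing : ∀ (t : unitInterval) (k M N m : ℕ) (hk : (0 : ℝ) < 2 * (k : ℝ) + 2), 3 * M + 16 ≤ (4 * k + 4) * m → 5 * m ≤ 7 * N → cornerCrossingProb t (rectQuad 0 1 0 (2 * (k : ℝ) + 2) one_pos hk) (1 / (m : ℝ)) ≤ (cornerPercolation t).real (lrCrossing M N) := by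
  intro t k M N m hk h₁ h₂
  -- numerics: `m ≥ 1`, `7/5 < √2 < 3/2`, the hypotheses cast to `ℝ`
  have hs := sqrt_two_bounds
  have hsqrt : (0 : ℝ) < Real.sqrt 2 := by linarith [hs.1]
  have hm1 : 1 ≤ m := Nat.pos_of_ne_zero fun hm => by simp [hm] at h₁
  have hm1R : (1 : ℝ) ≤ m := by exact_mod_cast hm1
  have hm0 : (0 : ℝ) < m := by linarith
  have hm0' : (m : ℝ) ≠ 0 := hm0.ne'
  have hM0 : (0 : ℝ) ≤ M := Nat.cast_nonneg M
  have hN0 : (0 : ℝ) ≤ N := Nat.cast_nonneg N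
  have h₁R : 3 * (M : ℝ) + 16 ≤ (4 * (k : ℝ) + 4) * m := by exact_mod_cast h₁
  have h₂R : 5 * (m : ℝ) ≤ 7 * N := by exact_mod_cast h₂
  have hδ : (0 : ℝ) < 1 / (m : ℝ) := one_div_pos.2 hm0
  -- Step 1: the forced horizontal gate at `Q = (0, 1) × (0, H)`, `H = 2k + 2`, mesh `δ = 1/m`,
  -- `y₁ = 2δ`, `y₂ = H - 2δ`, `x₁ = 0`, `x₂ = 1`, `a = m`, `b = H m - 8`
  have hA : ∀ p ∈ (rectQuad 0 1 0 (2 * (k : ℝ) + 2) one_pos hk).carrier,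
      infDist p ((rectQuad 0 1 0 (2 * (k : ℝ) + 2) one_pos hk).arc 0) ≤ 2 * (1 / (m : ℝ)) →
      p.im ≤ 2 * (1 / (m : ℝ)) := fun p _ hp => by
    linarith [im_sub_le_infDist_rectQuad_arc_zero one_pos hk p]
  have hB : ∀ p ∈ (rectQuad 0 1 0 (2 * (k : ℝ) + 2) one_pos hk).carrier,
      infDist p ((rectQuad 0 1 0 (2 * (k : ℝ) + 2) one_pos hk).arc 2) ≤ 2 * (1 / (m : ℝ)) →
      2 * (k : ℝ) + 2 - 2 * (1 / (m : ℝ)) ≤ p.im := fun p _ hp => by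
    linarith [sub_im_le_infDist_rectQuad_arc_two one_pos hk p]
  have hΩ : ∀ p ∈ (rectQuad 0 1 0 (2 * (k : ℝ) + 2) one_pos hk).carrier,
      2 * (1 / (m : ℝ)) ≤ p.im → p.im ≤ 2 * (k : ℝ) + 2 - 2 * (1 / (m : ℝ)) →
      (0 : ℝ) ≤ p.re ∧ p.re ≤ 1 := fun p hp _ _ => by
    rw [mem_rectQuad_carrier] at hp
    exact ⟨hp.1.1.le, hp.1.2.le⟩
  have hb : (0 : ℝ) ≤ (2 * (k : ℝ) + 2) * m - 8 := by linarith
  have hby : (2 * (k : ℝ) + 2) * m - 8 ≤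
      (2 * (k : ℝ) + 2 - 2 * (1 / (m : ℝ)) - 2 * (1 / (m : ℝ))) / (1 / (m : ℝ)) - 4 := by
    have e : (2 * (k : ℝ) + 2 - 2 * (1 / (m : ℝ)) - 2 * (1 / (m : ℝ))) / (1 / (m : ℝ)) =
        (2 * (k : ℝ) + 2) * m - 4 := by
      field_simp
      ring
    rw [e]
    linarith
  have ha : (1 - 0) / (1 / (m : ℝ)) ≤ (m : ℝ) := by
    rw [sub_zero, one_div_one_div]
  obtain ⟨w, hw⟩ := stub_gateTB (rectQuad 0 1 0 (2 * (k : ℝ) + 2) one_pos hk).carrier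
    ((rectQuad 0 1 0 (2 * (k : ℝ) + 2) one_pos hk).arc 0)
    ((rectQuad 0 1 0 (2 * (k : ℝ) + 2) one_pos hk).arc 2) hδ hA hB hΩ hb hby ha
  -- Step 2: `P_t(Q, 1/m)` is the `M_t`-probability of the crude crossing event
  rw [Literature.Probability.Percolation.cornerCrossingProb_eq]
  -- Step 3: lattice conversion of the transposed (horizontal) crossing of
  -- `w̃ + [0, H m - 8] × [0, m]`, `w̃ = (im w, re w)`
  set iL : ℤ := ⌊w.im / Real.sqrt 2⌋ with hiL
  set iR : ℤ := ⌈(w.im + ((2 * (k : ℝ) + 2) * m - 8)) / Real.sqrt 2⌉ with hiR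
  set jB : ℤ := ⌈w.re / Real.sqrt 2⌉ with hjB
  set jT : ℤ := ⌊(w.re + m) / Real.sqrt 2⌋ with hjT
  have hiL' : (iL : ℝ) ≤ w.im / Real.sqrt 2 := Int.floor_le _
  have hiR' : (w.im + ((2 * (k : ℝ) + 2) * m - 8)) / Real.sqrt 2 ≤ iR := Int.le_ceil _
  have hjB' : w.re / Real.sqrt 2 ≤ jB := Int.le_ceil _
  have hjT' : (jT : ℝ) ≤ (w.re + m) / Real.sqrt 2 := Int.floor_le _
  have hconv := cornerPercolation_real_embRectCrossing_le_real_lrCrossing t ⟨w.im, w.re⟩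
    ((2 * (k : ℝ) + 2) * m - 8) m iL iR jB jT
    (fun (s : ℤ) (hs' : Real.sqrt 2 * s ≤ w.im) => by
      rw [hiL]
      refine Int.le_floor.2 ?_
      rw [le_div_iff₀ hsqrt]
      linarith)
    (fun (s : ℤ) (hs' : w.im + ((2 * (k : ℝ) + 2) * m - 8) ≤ Real.sqrt 2 * s) => by
      rw [hiR]
      refine Int.ceil_le.2 ?_
      rw [div_le_iff₀ hsqrt]
      linarith)
    (by
      have h3 : w.im / Real.sqrt 2 ≤ (w.im + ((2 * (k : ℝ) + 2) * m - 8)) / Real.sqrt 2 :=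
        div_le_div_of_nonneg_right (by linarith) hsqrt.le
      exact_mod_cast hiL'.trans (h3.trans hiR'))
    (fun (s : ℤ) (hs' : w.re ≤ Real.sqrt 2 * s) => by
      rw [hjB]
      refine Int.ceil_le.2 ?_
      rw [div_le_iff₀ hsqrt]
      linarith)
    (fun (s : ℤ) (hs' : Real.sqrt 2 * s ≤ w.re + m) => by
      rw [hjT]
      refine Int.le_floor.2 ?_
      rw [le_div_iff₀ hsqrt]
      linarith)
  -- Step 4: the lattice rectangle is at least `M` wide and at most `N` high
  have hwidth : M ≤ (iR - iL).toNat := by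
    have h1 : (M : ℝ) * Real.sqrt 2 ≤ (M : ℝ) * (3 / 2) := mul_le_mul_of_nonneg_left hs.2.le hM0
    have h2 : (M : ℝ) ≤
        (w.im + ((2 * (k : ℝ) + 2) * m - 8)) / Real.sqrt 2 - w.im / Real.sqrt 2 := by
      rw [← sub_div, le_div_iff₀ hsqrt]
      linarith
    have h3 : ((M : ℤ) : ℝ) ≤ iR - iL := by
      push_cast
      linarith
    have h4 : (M : ℤ) ≤ iR - iL := by exact_mod_cast h3
    omega
  have hheight : (jT - jB).toNat ≤ N := by
    have h1 : (N : ℝ) * (7 / 5) ≤ (N : ℝ) * Real.sqrt 2 :=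
      mul_le_mul_of_nonneg_left hs.1.le hN0
    have h2 : (w.re + m) / Real.sqrt 2 - w.re / Real.sqrt 2 ≤ (N : ℝ) := by
      rw [← sub_div, div_le_iff₀ hsqrt]
      linarith
    have h3 : ((jT - jB : ℤ) : ℝ) ≤ ((N : ℤ) : ℝ) := by
      push_cast
      linarith
    have h4 : jT - jB ≤ (N : ℤ) := by exact_mod_cast h3
    omega
  -- Step 5: the chain
  calc (cornerPercolation t).real (embDomainCrossing squareLatticeEmbedding.z
          (rectQuad 0 1 0 (2 * (k : ℝ) + 2) one_pos hk).carrier (1 / (m : ℝ))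
          ((rectQuad 0 1 0 (2 * (k : ℝ) + 2) one_pos hk).arc 0)
          ((rectQuad 0 1 0 (2 * (k : ℝ) + 2) one_pos hk).arc 2))
      ≤ (cornerPercolation t).real (embTBCrossing (fun v => squareLatticeEmbedding.z v - w) m
          ((2 * (k : ℝ) + 2) * m - 8)) :=
        cornerPercolation_real_mono_of_lattice' t hw
    _ = (cornerPercolation t).real (embRectCrossing
          (fun v => squareLatticeEmbedding.z v - ⟨w.im, w.re⟩) ((2 * (k : ℝ) + 2) * m - 8) m) :=
        cornerPercolation_real_embTBCrossing_eq_real_embRectCrossing t w m _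
    _ ≤ (cornerPercolation t).real (lrCrossing (iR - iL).toNat (jT - jB).toNat) := hconv
    _ ≤ (cornerPercolation t).real (lrCrossing M (jT - jB).toNat) :=
        cornerPercolation_real_lrCrossing_anti_left t hwidth _
    _ ≤ (cornerPercolation t).real (lrCrossing M N) :=
        measureReal_mono (lrCrossing_mono_right M hheight)

end Summit.CriticalPhenomena.CardyFormulaZ2.Cruxes.UniformMarginality.HeatFlow

end
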